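import Summits.ResolutionOfSingularities.ResolutionOfSingularities.Theorems.EquisingularLiftEquisingularLiftNatNonCartierFibre
import Literature.AlgebraicGeometry.Motives.ProjBaseChangeAny
import Literature.AlgebraicGeometry.Motives.ProjectiveNoetherNormalization
import Literature.AlgebraicGeometry.Resolution.AffineBlowupIntegral
import Summits.ResolutionOfSingularities.ResolutionOfSingularities.Theorems.EquisingularLiftEquisingularLiftReducedStrictTransformBlowup
import HarnessLib

/-!
# [OURS · L1 W4.5(b) · EL♮] T-FIBRE-2: the fibre of a blowing up over a point of a quasi-regular centre is
# an embedded `ℙʳ_{κ(y)}`; on `ℙ¹` a point with a proper specialisation is generic; hence the strict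
# transform of a regular surface germ blown up in an `𝔪`-primary (non-Cartier) trace contains the WHOLE
# fibre `e_q`

HONEST FRAMING. OURS (cell res-hironaka, crux chain w45b, slot W4.5(b)); NOT a statement of any manuscript;
AI-written, weaker than expert review. Helper `--supports stmt-ResolutionOfSingularities-20038 --as helper`
(crux `EquisingularLiftNat`, research stub `stub_elnat_three_isolated`), sequel of
`…EquisingularLiftNatNonCartierFibre` (p508194, T-FIBRE: «positive-dimensional fibre»). This file proves the
literal wording of res-L1-w45b-lead-2's typed target T-FIBRE, LEAD-MEMO-2 §4: «`St_s(D) ⊇ e_q` when `D ∩ s` is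
not Cartier» (regular-model / distance-one sub-case of the memo's §1, cf. its ERRATUM §9).

* §1 `exists_preimmersion_projectiveSpace_range_eq_fibre` — for a blowing up `π : X' → X` along `J`
  (`IsBlowup`, universal property) and a point `y` with `J_y = (c₀, …, c_r)` QUASI-REGULAR in `𝔪_y`: there is a
  PREIMMERSION `g : ℙʳ_{κ(y)} → X'` with image exactly `π⁻¹(y)`. Assembly: the affine model
  `Bl_{J_y}(Spec 𝒪_{X,y}) ≅ X' ×_X Spec 𝒪_{X,y}` (blowing ups commute with flat base change + uniqueness), its
  exceptional divisor `E ≅ ℙʳ_{𝒪_{X,y}/J_y}` (Hartshorne II 8.24 (b), tree `isPullback_exceptional_projectiveSpace`),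
  the base change `ℙʳ_κ = ℙʳ_𝒪 ×_𝒪 Spec κ` (tree `isPullback_projMap'`) giving the closed fibre `ℙʳ_κ → E` as a base
  change of `Spec κ ↪ V(J_y)` (`IsPullback.of_right`), and the pro-open preimmersion `X' ×_X Spec 𝒪_{X,y} → X'`
  (Mathlib: `fromSpecStalk` is a preimmersion, preimmersions are stable under base change and composition).
* §2 `irreducibleSpace_proj_mvPolynomial'`, `projectiveLine_specializes_of_specializes_of_ne` — `ℙ¹_K` (`K` a field)
  is irreducible of topological Krull dimension `1` (tree `ProjSpace.topologicalKrullDim_eq`), so a point `z₁` with a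
  specialisation `z₁ ⤳ z₀ ≠ z₁` is the generic point: `z₁ ⤳ z` for every `z` (else `η > z₁ > z₀` would be a chain of
  length `2` in Mathlib's specialisation preorder of the scheme).
* §3 `preimage_subset_closure_strictTransform_of_surface` — **T-FIBRE-2**: `τ : X' → X` a proper blowing up along
  `C` with `C_y = (u₀, u₁)` quasi-regular in `𝔪_y` (codimension-`2` regular centre through `y`, e.g. a section of a
  threefold over a DVR); `S ∋ y` closed irreducible, `S ⊄ V(C)`, with `D = V(S)_red` regular of dimension `2` at its
  point `z` over `y` and `(C·𝒪_D)_z = (a, b)` `𝔪_z`-primary ⇒ **`τ⁻¹(y) ⊆ closure τ⁻¹(S ∖ V(C)) = St(D)`**. Proof: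
  `St(D)_red → D` is the blowing up along `C·𝒪_D` (`StrataSplit.exists_isBlowup_reducedStrictTransform`, Stacks
  080E); T-FIBRE (`exists_specializes_ne_of_surface`, p508194) gives distinct `x₁ ⤳ x₀` in `St(D)` over `y`; in
  `e_y ≅ ℙ¹_{κ(y)}` (§1, embedding) `x₁` is therefore the generic point (§2); `St(D)` is closed.

LIMITS. The centre must be generated at `y` by a quasi-regular PAIR and its trace on `D` by two elements with
`𝔪`-primary span (true for a section `s ⊄ D` of a regular threefold through a point of a regular surface `D`);
more generators / higher codimension: §1 still gives `e_y ≅ ℙʳ`, but «whole fibre» needs `r = 1`. Grading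
instances are supplied by `letI := MvPolynomial.gradedAlgebra` inside statements (no instance attributes).

References: R. Hartshorne, *Algebraic Geometry*, II Thm. 8.24 (b) [Hartshorne1977]; The Stacks Project, Tags 0804,
0805, 080E [StacksProject]; U. Görtz, T. Wedhorn, *Algebraic Geometry I*, Cor. 5.18 [GortzWedhorn2020] — through the
cited tree files. OURS planning texts (index only): `L/res-L1-w45b-lead-2/LEAD-MEMO-2.md`.
-/

set_option linter.dupNamespace false -- mandated namespace `Summit.<Summit>.<Problem>` of this single-conjunct summit

noncomputable section

open CategoryTheory CategoryTheory.Limits AlgebraicGeometry TopologicalSpace Topology IsLocalRing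
open Literature.AlgebraicGeometry.Resolution
open Literature.AlgebraicGeometry.Motives Literature.AlgebraicGeometry.Motives.ProjBaseChangeRing

universe u

namespace Summit.ResolutionOfSingularities.ResolutionOfSingularities.Cruxes.EquisingularLiftNat.Sections

/-! ## §1 The fibre over `y` of a blowing up with `J_y` quasi-regular is an embedded `ℙʳ_{κ(y)}` -/

section Fibre

open Scheme.IdealSheafData

variable {X' X : Scheme.{u}} {π : X' ⟶ X} {J : X.IdealSheafData}

/-- `Spec κ(y) → Spec 𝒪_{X,y}` hits only the closed point. [folklore] -/
theorem specMap_residue_apply (O : Type u) [CommRing O] [IsLocalRing O]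
    (t : Spec (.of (ResidueField O))) :
    Spec.map (CommRingCat.ofHom (residue O)) t = closedPoint O := by
  rw [Spec.map_apply, CommRingCat.hom_ofHom]
  exact IsLocalRing.PrimeSpectrum.comap_residue O t

/-- **The fibre of a blowing up over a point of a quasi-regular centre is an embedded projective space.**
Let `π : X' → X` be a blowing up along `J` and `y ∈ X` with `J_y = (c₀, …, c_r)` for a quasi-regular
sequence `c` in `𝔪_y`. Then there is a PREIMMERSION `g : ℙʳ_{κ(y)} → X'` (a topological embedding) whose
image is exactly the fibre `π⁻¹(y)`: the closed fibre of the exceptional divisor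
`E ≅ ℙʳ_{𝒪_{X,y}/J_y}` of the affine model `Bl_{J_y}(Spec 𝒪_{X,y}) ≅ X' ×_X Spec 𝒪_{X,y}` (Hartshorne II
8.24 (b), tree `isPullback_exceptional_projectiveSpace`; base change of `ℙʳ`, tree `isPullback_projMap'`),
followed by the pro-open preimmersion `X' ×_X Spec 𝒪_{X,y} → X'`.
[cite: Hartshorne1977, II Thm. 8.24 (b)] [cite: StacksProject, Tag 0804 and Tag 0805] -/
theorem exists_preimmersion_projectiveSpace_range_eq_fibre (hπ : IsBlowup π J) (y : X) {r : ℕ}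
    (c : Fin (r + 1) → X.presheaf.stalk y) (hc : Ideal.span (Set.range c) = stalkIdeal J y)
    (hcq : IsQuasiRegular c) (hcm : ∀ l, c l ∈ maximalIdeal (X.presheaf.stalk y)) :
    letI := MvPolynomial.gradedAlgebra (σ := Fin (r + 1)) (R := ResidueField (X.presheaf.stalk y))
    ∃ g : Proj (MvPolynomial.homogeneousSubmodule (Fin (r + 1)) (ResidueField (X.presheaf.stalk y))) ⟶ X',
      IsPreimmersion g ∧ Set.range g = π ⁻¹' {y} := by
  classical
  letI := MvPolynomial.gradedAlgebra (σ := Fin (r + 1)) (R := ResidueField (X.presheaf.stalk y))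
  letI := MvPolynomial.gradedAlgebra (σ := Fin (r + 1)) (R := X.presheaf.stalk y)
  -- the affine model `Bl_{(c)}(Spec 𝒪_{X,y}) ≅ X' ×_X Spec 𝒪_{X,y}`
  haveI : Flat (X.fromSpecStalk y) := flat_fromSpecStalk X y
  have hP : IsBlowup (pullback.snd π (X.fromSpecStalk y))
      (affineBlowup.idealSheaf (Ideal.span (Set.range c))) := by
    have h := hπ.pullback_snd_of_flat (X.fromSpecStalk y)
    rwa [comap_fromSpecStalk_eq_affineBlowupIdealSheaf, ← hc] at h
  obtain ⟨e, he, -⟩ := (affineBlowup.isBlowup (Ideal.span (Set.range c))).unique hP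
  have hfπ : (e.hom ≫ pullback.fst π (X.fromSpecStalk y)) ≫ π =
      affineBlowup.π (Ideal.span (Set.range c)) ≫ X.fromSpecStalk y := by
    rw [Category.assoc, pullback.condition, ← Category.assoc, he]
  -- the centre `V(c) ↪ Spec 𝒪` and the residue field `Spec κ ↪ V(c)`
  haveI : IsClosedImmersion
      (Spec.map (CommRingCat.ofHom (Ideal.Quotient.mk (Ideal.span (Set.range c))))) :=
    IsClosedImmersion.spec_of_surjective _ Ideal.Quotient.mk_surjective
  have hIle : Ideal.span (Set.range c) ≤ maximalIdeal (X.presheaf.stalk y) :=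
    Ideal.span_le.mpr (by rintro _ ⟨l, rfl⟩; exact hcm l)
  let q : (X.presheaf.stalk y ⧸ Ideal.span (Set.range c)) →+* ResidueField (X.presheaf.stalk y) :=
    Ideal.Quotient.lift _ (residue _) fun a ha => (residue_eq_zero_iff _).mpr (hIle ha)
  have hq : q.comp (Ideal.Quotient.mk _) = residue (X.presheaf.stalk y) :=
    RingHom.ext fun a => by rw [RingHom.comp_apply]; exact Ideal.Quotient.lift_mk _ _ _
  have hqsurj : Function.Surjective q := fun x => by
    obtain ⟨a, rfl⟩ := residue_surjective x
    exact ⟨Ideal.Quotient.mk _ a, Ideal.Quotient.lift_mk _ _ _⟩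
  haveI : IsClosedImmersion (Spec.map (CommRingCat.ofHom q)) :=
    IsClosedImmersion.spec_of_surjective _ hqsurj
  have hjκ : Spec.map (CommRingCat.ofHom q) ≫
      Spec.map (CommRingCat.ofHom (Ideal.Quotient.mk (Ideal.span (Set.range c)))) =
        Spec.map (CommRingCat.ofHom (algebraMap (X.presheaf.stalk y)
          (ResidueField (X.presheaf.stalk y)))) := by
    rw [← Spec.map_comp, ← CommRingCat.ofHom_comp, hq, ResidueField.algebraMap_eq]
  have hκpt : ∀ t, Spec.map (CommRingCat.ofHom (algebraMap (X.presheaf.stalk y)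
      (ResidueField (X.presheaf.stalk y)))) t = closedPoint (X.presheaf.stalk y) := fun t => by
    rw [ResidueField.algebraMap_eq]; exact specMap_residue_apply _ t
  -- the two cartesian squares: `E ≅ ℙʳ_{𝒪/(c)}` and `ℙʳ_κ = ℙʳ_𝒪 ×_𝒪 Spec κ`
  have H := isPullback_exceptional_projectiveSpace c
    (Spec.map (CommRingCat.ofHom (Ideal.Quotient.mk (Ideal.span (Set.range c)))))
    (ker_specMap_quotientMk_span c) hcq
  have S2 := isPullback_projMap' (X.presheaf.stalk y) (ResidueField (X.presheaf.stalk y)) (n := r)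
  have w : Proj.map (mapGraded (X.presheaf.stalk y) (ResidueField (X.presheaf.stalk y)) (Fin (r + 1)))
        (irrelevant_le_map (X.presheaf.stalk y) (ResidueField (X.presheaf.stalk y)) (Fin (r + 1))) ≫
      projToSpec (Fin (r + 1)) (X.presheaf.stalk y) =
      (projToSpec (Fin (r + 1)) (ResidueField (X.presheaf.stalk y)) ≫ Spec.map (CommRingCat.ofHom q)) ≫
        Spec.map (CommRingCat.ofHom (Ideal.Quotient.mk (Ideal.span (Set.range c)))) := by
    rw [Category.assoc, hjκ]
    exact S2.w
  -- `gE : ℙʳ_κ → E`, the closed fibre of the exceptional divisor (a base change of `Spec κ ↪ V(c)`)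
  obtain ⟨gE, hgE1, hgE2⟩ : ∃ gE, gE ≫ (pullback.fst (affineBlowup.π (Ideal.span (Set.range c)))
      (Spec.map (CommRingCat.ofHom (Ideal.Quotient.mk (Ideal.span (Set.range c))))) ≫
        Proj.map (reesPresentation c) (irrelevant_le_map_reesPresentation c)) =
      Proj.map (mapGraded (X.presheaf.stalk y) (ResidueField (X.presheaf.stalk y)) (Fin (r + 1)))
        (irrelevant_le_map (X.presheaf.stalk y) (ResidueField (X.presheaf.stalk y)) (Fin (r + 1))) ∧
      gE ≫ pullback.snd (affineBlowup.π (Ideal.span (Set.range c)))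
        (Spec.map (CommRingCat.ofHom (Ideal.Quotient.mk (Ideal.span (Set.range c))))) =
      projToSpec (Fin (r + 1)) (ResidueField (X.presheaf.stalk y)) ≫ Spec.map (CommRingCat.ofHom q) :=
    ⟨H.lift _ _ w, H.lift_fst _ _ w, H.lift_snd _ _ w⟩
  have HL : IsPullback gE (projToSpec (Fin (r + 1)) (ResidueField (X.presheaf.stalk y)))
      (pullback.snd (affineBlowup.π (Ideal.span (Set.range c)))
        (Spec.map (CommRingCat.ofHom (Ideal.Quotient.mk (Ideal.span (Set.range c))))))
      (Spec.map (CommRingCat.ofHom q)) := by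
    refine IsPullback.of_right ?_ hgE2 H
    rw [hgE1, hjκ]
    exact S2
  haveI : IsPreimmersion gE :=
    MorphismProperty.IsStableUnderBaseChange.of_isPullback HL.flip inferInstance
  refine ⟨gE ≫ pullback.fst (affineBlowup.π (Ideal.span (Set.range c)))
      (Spec.map (CommRingCat.ofHom (Ideal.Quotient.mk (Ideal.span (Set.range c))))) ≫
      e.hom ≫ pullback.fst π (X.fromSpecStalk y), inferInstance, ?_⟩
  ext x'
  constructor
  · rintro ⟨z, rfl⟩
    rw [Set.mem_preimage, Set.mem_singleton_iff, ← Scheme.Hom.comp_apply]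
    have hcomp : (gE ≫ pullback.fst (affineBlowup.π (Ideal.span (Set.range c)))
        (Spec.map (CommRingCat.ofHom (Ideal.Quotient.mk (Ideal.span (Set.range c))))) ≫
        e.hom ≫ pullback.fst π (X.fromSpecStalk y)) ≫ π =
        projToSpec (Fin (r + 1)) (ResidueField (X.presheaf.stalk y)) ≫
          Spec.map (CommRingCat.ofHom (algebraMap (X.presheaf.stalk y)
            (ResidueField (X.presheaf.stalk y)))) ≫ X.fromSpecStalk y := by
      simp only [Category.assoc]
      rw [pullback.condition, reassoc_of% he, pullback.condition_assoc, reassoc_of% hgE2,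
        reassoc_of% hjκ]
    rw [hcomp, Scheme.Hom.comp_apply, Scheme.Hom.comp_apply, hκpt]
    exact Scheme.fromSpecStalk_closedPoint
  · intro hx'
    rw [Set.mem_preimage, Set.mem_singleton_iff] at hx'
    -- a point of the affine model over the closed point …
    obtain ⟨b, hb⟩ := mem_range_pullback_fst_fromSpecStalk_of_eq π y hx'
    have ha : affineBlowup.π (Ideal.span (Set.range c)) (e.inv b) = closedPoint (X.presheaf.stalk y) := by
      apply (X.fromSpecStalk y).isEmbedding.injective
      rw [Scheme.fromSpecStalk_closedPoint, ← Scheme.Hom.comp_apply, ← Scheme.Hom.comp_apply, ← he]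
      simp only [Category.assoc, Iso.inv_hom_id_assoc]
      rw [← pullback.condition, Scheme.Hom.comp_apply, hb, hx']
    -- … lies on the exceptional divisor, over the point `Spec κ` of the centre …
    have hmem : e.inv b ∈ Set.range (pullback.fst (affineBlowup.π (Ideal.span (Set.range c)))
        (Spec.map (CommRingCat.ofHom (Ideal.Quotient.mk (Ideal.span (Set.range c)))))) := by
      rw [Scheme.Pullback.range_fst]
      exact ⟨Spec.map (CommRingCat.ofHom q) (closedPoint (ResidueField (X.presheaf.stalk y))), by
        rw [← Scheme.Hom.comp_apply, hjκ, hκpt, ha]⟩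
    obtain ⟨e₁, he₁⟩ := hmem
    have ht : pullback.snd (affineBlowup.π (Ideal.span (Set.range c)))
        (Spec.map (CommRingCat.ofHom (Ideal.Quotient.mk (Ideal.span (Set.range c))))) e₁ =
        Spec.map (CommRingCat.ofHom q) (closedPoint (ResidueField (X.presheaf.stalk y))) := by
      apply (Spec.map (CommRingCat.ofHom (Ideal.Quotient.mk (Ideal.span (Set.range c))))).isClosedEmbedding.injective
      rw [← Scheme.Hom.comp_apply, ← pullback.condition, Scheme.Hom.comp_apply, he₁, ha,
        ← Scheme.Hom.comp_apply, hjκ, hκpt]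
    -- … hence comes from `ℙʳ_κ`
    obtain ⟨w', hw', -⟩ := Scheme.Pullback.exists_preimage_pullback e₁ _ ht
    refine ⟨HL.isoPullback.inv w', ?_⟩
    rw [← Scheme.Hom.comp_apply, HL.isoPullback_inv_fst_assoc, Scheme.Hom.comp_apply, hw',
      Scheme.Hom.comp_apply, he₁, ← Scheme.Hom.comp_apply, Iso.inv_hom_id_assoc, hb]

end Fibre

/-! ## §2 On `ℙ¹_K` a point with a proper specialisation is the generic point -/

section ProjectiveLine

/-- `ℙʳ_R = Proj R[T₀, …, T_r]` is irreducible for a domain `R` (Mathlib-style `Proj.irreducibleSpace` of the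
tree: the irrelevant ideal contains `T₀ ≠ 0`). -- adapted from the private
`Literature.AlgebraicGeometry.Resolution.irreducibleSpace_proj_mvPolynomial` [folklore] -/
theorem irreducibleSpace_proj_mvPolynomial' (R : Type u) [CommRing R] [IsDomain R] (r : ℕ) :
    letI := MvPolynomial.gradedAlgebra (σ := Fin (r + 1)) (R := R)
    IrreducibleSpace (Proj (MvPolynomial.homogeneousSubmodule (Fin (r + 1)) R)) := by
  letI := MvPolynomial.gradedAlgebra (σ := Fin (r + 1)) (R := R)
  refine Proj.irreducibleSpace (MvPolynomial.homogeneousSubmodule (Fin (r + 1)) R) ?_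
  intro h
  have hx : (MvPolynomial.X 0 : MvPolynomial (Fin (r + 1)) R) ∈
      (HomogeneousIdeal.irrelevant (MvPolynomial.homogeneousSubmodule (Fin (r + 1)) R)).toIdeal :=
    HomogeneousIdeal.mem_irrelevant_of_mem _ zero_lt_one (MvPolynomial.isHomogeneous_X R 0)
  rw [h] at hx
  exact MvPolynomial.X_ne_zero 0 ((Submodule.mem_bot _).1 hx)

/-- **On the projective line a point with a proper specialisation is the generic point**: for a field `K`
and points `z₁ ⤳ z₀`, `z₁ ≠ z₀` of `ℙ¹_K = Proj K[T₀, T₁]`, `z₁` specialises to EVERY point. Indeed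
`ℙ¹_K` is irreducible of topological Krull dimension `1` (tree `ProjSpace.topologicalKrullDim_eq`); were
`z₁` not the generic point `η`, `η ⤳ z₁ ⤳ z₀` would be a chain of length `2` in the specialisation order.
[cite: GortzWedhorn2020, Cor. 5.18 (p. 156)] -/
theorem projectiveLine_specializes_of_specializes_of_ne (K : Type u) [Field K] :
    letI := MvPolynomial.gradedAlgebra (σ := Fin (1 + 1)) (R := K)
    ∀ z₁ z₀ z : Proj (MvPolynomial.homogeneousSubmodule (Fin (1 + 1)) K), z₁ ⤳ z₀ → z₁ ≠ z₀ → z₁ ⤳ z := by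
  letI := MvPolynomial.gradedAlgebra (σ := Fin (1 + 1)) (R := K)
  intro z₁ z₀ z h10 hne
  haveI := irreducibleSpace_proj_mvPolynomial' K 1
  by_cases hz : z₁ = genericPoint (Proj (MvPolynomial.homogeneousSubmodule (Fin (1 + 1)) K))
  · rw [hz]
    exact genericPoint_specializes z
  exfalso
  -- the chain `η > z₁ > z₀` in Mathlib's specialisation preorder of the scheme (`a ≤ b ↔ b ⤳ a`)
  have h1 : z₀ < z₁ := by
    refine lt_iff_le_not_ge.mpr ⟨Scheme.le_iff_specializes.mpr h10, fun h => hne ?_⟩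
    exact (h10.antisymm (Scheme.le_iff_specializes.mp h)).eq
  have h2 : z₁ < genericPoint _ := by
    refine lt_iff_le_not_ge.mpr ⟨Scheme.le_iff_specializes.mpr (genericPoint_specializes z₁), fun h => hz ?_⟩
    exact ((Scheme.le_iff_specializes.mp h).antisymm (genericPoint_specializes z₁)).eq
  have hsm : StrictMono ![z₀, z₁, genericPoint (Proj (MvPolynomial.homogeneousSubmodule (Fin (1 + 1)) K))] := by
    refine Fin.strictMono_iff_lt_succ.mpr fun i => ?_
    fin_cases i
    · exact h1
    · exact h2
  have hq := Order.LTSeries.length_le_krullDim (LTSeries.mk 2 _ hsm)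
  have hcar : topologicalKrullDim (Proj (MvPolynomial.homogeneousSubmodule (Fin (1 + 1)) K)) =
      Order.krullDim (Proj (MvPolynomial.homogeneousSubmodule (Fin (1 + 1)) K)) :=
    Order.krullDim_eq_of_orderIso
      (irreducibleSetEquivPoints (α := Proj (MvPolynomial.homogeneousSubmodule (Fin (1 + 1)) K)))
  have hdim : topologicalKrullDim (Proj (MvPolynomial.homogeneousSubmodule (Fin (1 + 1)) K)) = (1 : ℕ) :=
    ProjSpace.topologicalKrullDim_eq 1 K
  rw [← hcar, hdim] at hq
  exact absurd (by exact_mod_cast hq : (2 : ℕ) ≤ 1) (by norm_num)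

end ProjectiveLine

/-! ## §3 T-FIBRE-2: the strict transform of a regular surface germ contains the whole fibre `e_q` -/

section StrictTransform

open Scheme.IdealSheafData

/-- **T-FIBRE-2 «`St_s(D) ⊇ e_q` when `D ∩ s` is not Cartier»** (res-L1-w45b-lead-2, LEAD-MEMO-2 §1/§4), in the
strict-transform currency of the chain (`StrataSplit.exists_isBlowup_reducedStrictTransform`). Let `τ : X' → X` be a
proper blowing up of the locally Noetherian `X` along `C`, whose stalk at the point `y` is generated by a
quasi-regular sequence `u₀, u₁ ∈ 𝔪_y` of length TWO (a codimension-`2` regular centre through `y`, e.g. a section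
`s` of a threefold over a DVR), so that the fibre `e_y := τ⁻¹(y)` is an embedded `ℙ¹_{κ(y)}` (§1). Let `S ∋ y` be a
closed irreducible subset, `S ⊄ V(C)`, whose reduced induced subscheme `D = V(S)_red` has REGULAR two-dimensional
local ring at (its point `z` over) `y`, and suppose the restricted centre `(C·𝒪_D)_z = (a, b)` is `𝔪_z`-primary
(`rad = 𝔪_z`; NOT Cartier). Then the strict transform `St(D) = closure τ⁻¹(S ∖ V(C))` CONTAINS THE WHOLE FIBRE:
`τ⁻¹(y) ⊆ St(D)`. Proof: `St(D)_red → D` is the blowing up of `D` along `C·𝒪_D` (Stacks 080E), so by T-FIBRE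
(`exists_specializes_ne_of_surface`) it has two distinct points `x₁ ⤳ x₀` over `y`; read in `e_y ≅ ℙ¹_{κ(y)}`
(§1, an embedding) `x₁` has a proper specialisation, hence is the generic point of `e_y` (§2), and `St(D)` is
closed. [cite: StacksProject, Tag 080E] [cite: Hartshorne1977, II Thm. 8.24 (b)] -/
theorem preimage_subset_closure_strictTransform_of_surface (X X' : Scheme.{0}) [IsLocallyNoetherian X]
    [IsLocallyNoetherian X'] (τ : X' ⟶ X) (C : X.IdealSheafData) (hτ : IsBlowup τ C) [IsProper τ]
    (S : Set X) (hS : IsClosed S) (hirr : IsIrreducible S) (hSC : ¬ S ⊆ (C.support : Set X))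
    (y : X) (u : Fin (1 + 1) → X.presheaf.stalk y) (hu : Ideal.span (Set.range u) = stalkIdeal C y)
    (huq : IsQuasiRegular u) (hum : ∀ l, u l ∈ maximalIdeal (X.presheaf.stalk y))
    (z : ↥(vanishingIdeal (⟨S, hS⟩ : Closeds X)).subscheme)
    (hz : (vanishingIdeal (⟨S, hS⟩ : Closeds X)).subschemeι z = y)
    [IsRegularLocalRing ((vanishingIdeal (⟨S, hS⟩ : Closeds X)).subscheme.presheaf.stalk z)]
    (hdim : ringKrullDim ((vanishingIdeal (⟨S, hS⟩ : Closeds X)).subscheme.presheaf.stalk z) = (2 : ℕ))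
    (a b : (vanishingIdeal (⟨S, hS⟩ : Closeds X)).subscheme.presheaf.stalk z)
    (hab : Ideal.span {a, b} =
      stalkIdeal (C.comap (vanishingIdeal (⟨S, hS⟩ : Closeds X)).subschemeι) z)
    (hrad : (stalkIdeal (C.comap (vanishingIdeal (⟨S, hS⟩ : Closeds X)).subschemeι) z).radical =
      maximalIdeal _) :
    τ ⁻¹' {y} ⊆ closure (τ ⁻¹' (S \ (C.support : Set X))) := by
  classical
  -- the strict transform is the blowing up of `D = V(S)_red` along `C·𝒪_D`
  obtain ⟨ρ, hρ, -, hρbl⟩ :=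
    Cruxes.EquisingularLift.StrataSplit.exists_isBlowup_reducedStrictTransform X X' τ C hτ S hS hirr hSC
  -- T-FIBRE: two distinct points `t₁ ⤳ t₀` of the strict transform over `z`
  obtain ⟨t₁, t₀, ht₁, ht₀, hne, hsp⟩ := exists_specializes_ne_of_surface hρbl z hdim a b hab hrad
  have hτt : ∀ t, ρ t = z →
      τ ((vanishingIdeal (⟨closure (τ ⁻¹' (S \ (C.support : Set X))), isClosed_closure⟩ :
        Closeds X')).subschemeι t) = y := fun t ht => by
    rw [← Scheme.Hom.comp_apply, ← hρ, Scheme.Hom.comp_apply, ht, hz]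
  have hmem : (vanishingIdeal (⟨closure (τ ⁻¹' (S \ (C.support : Set X))), isClosed_closure⟩ :
      Closeds X')).subschemeι t₁ ∈ closure (τ ⁻¹' (S \ (C.support : Set X))) := by
    have h := Set.mem_range_self (f := (vanishingIdeal (⟨closure (τ ⁻¹' (S \ (C.support : Set X))),
      isClosed_closure⟩ : Closeds X')).subschemeι) t₁
    rwa [ComponentGluing.range_subschemeι_vanishingIdeal] at h
  -- the fibre `e_y ≅ ℙ¹_{κ(y)}`, embedded
  obtain ⟨g, hg, hrange⟩ := exists_preimmersion_projectiveSpace_range_eq_fibre hτ y u hu huq hum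
  obtain ⟨w₁, hw₁⟩ : (vanishingIdeal (⟨closure (τ ⁻¹' (S \ (C.support : Set X))), isClosed_closure⟩ :
      Closeds X')).subschemeι t₁ ∈ Set.range g := by
    rw [hrange]; exact hτt t₁ ht₁
  obtain ⟨w₀, hw₀⟩ : (vanishingIdeal (⟨closure (τ ⁻¹' (S \ (C.support : Set X))), isClosed_closure⟩ :
      Closeds X')).subschemeι t₀ ∈ Set.range g := by
    rw [hrange]; exact hτt t₀ ht₀
  have hw : w₁ ⤳ w₀ := by
    rw [← hg.isEmbedding.isInducing.specializes_iff, hw₁, hw₀]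
    exact hsp.map (Scheme.Hom.continuous _)
  have hwne : w₁ ≠ w₀ := fun h => hne
    ((vanishingIdeal (⟨closure (τ ⁻¹' (S \ (C.support : Set X))), isClosed_closure⟩ :
      Closeds X')).subschemeι.isClosedEmbedding.injective (by rw [← hw₁, ← hw₀, h]))
  -- every point of the fibre is a specialisation of `x₁ = g w₁ ∈ St(D)`, and `St(D)` is closed
  intro x hx
  obtain ⟨w, rfl⟩ : x ∈ Set.range g := by rw [hrange]; exact hx
  have hspec : g w₁ ⤳ g w :=
    (projectiveLine_specializes_of_specializes_of_ne _ w₁ w₀ w hw hwne).map (Scheme.Hom.continuous g)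
  exact hspec.mem_closed isClosed_closure (hw₁ ▸ hmem)

end StrictTransform

end Summit.ResolutionOfSingularities.ResolutionOfSingularities.Cruxes.EquisingularLiftNat.Sections

end
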